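import Literature.Barriers.CriticalPhenomena.TimarNonunimodularLevels
import Literature.Barriers.CriticalPhenomena.SubexponentialGrowthZdCoupling
import HarnessLib

/-!
# Timár 2006, §5: two uses of the nonunimodular MTP — Lemma 5.1 (finite trees have expected
# degree at most `2μ`) and unit-mass point allocations — PROVED, on an abstract invariant space

Barrier catalogue `Literature/Barriers/CriticalPhenomena/`; a brick of the programme proving
Timár's Thm. 5.5 (`Timar2006_finiteLevelUnion`, `TimarCriticalNonunimodular.lean`). Á. Timár,
*Percolation on nonunimodular transitive graphs*, Ann. Probab. 34 (2006) 2344–2364, §5: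

> **Lemma 5.1.** Suppose that `G` is a nonunimodular transitive graph and consider the
> 1-partition of `G` and some other random process `ω̂` that is invariant under `Aut(G)` and
> independent of the 1-partition. Let `H` be a random graph on `G` that is an equivariant
> function of the 1-partition and `ω̂` and such that (i) the endpoints of any edge of `H` are in
> the same class of the 1-partition and (ii) every component of `H` is a finite tree. Then the
> expected degree of a vertex, given that it is in `H`, is at most `2μ`.
>
> *Proof.* Perform the following mass transport. Start with `deg_H x` mass in each vertex and
> redistribute it equally among the vertices in its (finite) cluster. The mass received by a
> vertex `x` is the average degree in its finite component. Since the average degree in a finite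
> tree is `< 2`, we get that `E[deg_H x] = E[mass sent out] ≤ μ E[mass received] ≤ 2μ`, using
> Lemma 2.2. □

We formalise both MTP arguments of §5 that are used repeatedly, over an ABSTRACT invariant
probability space — a measure `P` on `Ω` preserved by measurable maps `act γ` (`γ ∈ Aut(G)`), as
in the random form of Lemma 2.2 (`lintegral_tsum_eq_inv_autWeight_mul`,
`TimarNonunimodularLevels.lean`) — so that the later bricks can apply them on the product space
carrying the percolation, the 1-partition, labels and the exhaustion:

* **Lemma 5.1** (`lintegral_encard_neighborSet_le`). The random graph is a measurable equivariant
  map `H : Ω → BondConfig V` (an arbitrary set of pairs, the "virtual" edges of Timár's forests,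
  not necessarily edges of `G`) together with a measurable equivariant vertex set `D ⊇` {non-isolated
  vertices}; hypothesis (ii) is "almost surely the open graph of `H` is acyclic with finite
  clusters"; hypothesis (i) enters only through its consequence actually used in the printed
  proof, **a bound `w(y) ≤ B w(x)` for `y` in the component of `x`** (inside a class of the
  1-partition, `B = μ`). Conclusion: `E[deg_H o] ≤ 2B · P(o ∈ D)`. The deterministic core is
  "`Σ_{x ∈ K} deg x + 2 = 2|K|` for a finite tree `K`" (`sum_ncard_neighborSet_add_two`, via
  Mathlib's `IsTree.card_edgeFinset` and the handshake lemma), packaged in the cluster-averaging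
  transport `treeTransport` ("redistribute it equally among the vertices in its cluster").
* **Unit-mass point allocations** (`lintegral_isSome_eq`): if every vertex `x` sends unit mass to
  at most one vertex `τ(x) ∈ V` (an equivariant measurable `τ : Ω → V → Option V`), then
  `P(τ(o) is defined) = w(o)⁻¹ E[Σ_{y : τ(y) = o} w(y)]`; hence, under a weight bound between a
  vertex and its target, the number of vertices allocated to `o` has expectation `≤ B` and is
  a.s. finite (`lintegral_encard_fiber_le`, `ae_finite_fiber`), and conversely
  `P(τ(o) defined) ≤ B · E[#fiber]` (`measure_isSome_le`). These are the MTPs of the proof of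
  Lemma 5.3 ("let each vertex `y` … send mass 1 to `x` … The expected mass sent out is at most
  1") and of the bag construction in the proof of Thm. 5.5.

## References

* Á. Timár, Ann. Probab. 34 (2006) 2344–2364 (arXiv:math/0702875), §5: Lemma 5.1 and its proof;
  proof of Lemma 5.3 (unit mass to an encounter point); proof of Thm. 5.5 (bags). [Timar2006]
* R. Lyons, Y. Peres, *Probability on Trees and Networks*, CUP 2016, Thm. 8.16 (proof: the
  cluster-averaging transport), Exercise 8.10, §8.2 ((8.10)). [LyonsPeres2016]
-/

noncomputable section

namespace Literature.Barriers.CriticalPhenomena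

open _root_.MeasureTheory Literature.Probability.Percolation SimpleGraph Finset
open scoped ENNReal

variable {V : Type*}

/-! ### Finite trees: `Σ_{x ∈ K} deg x + 2 = 2 |K|` for an arbitrary set of pairs -/

/-- Neighbours in the open graph of a pair set stay in the cluster. [folklore] -/
theorem neighborSet_subset_openCluster (H : BondConfig V) (x : V) :
    (openGraph H).neighborSet x ⊆ openCluster H x :=
  fun _ hy => Adj.reachable hy

/-- In a finite cluster every vertex has finitely many open neighbours. [folklore] -/
theorem finite_neighborSet_of_finite {H : BondConfig V} {o x : V} (hfin : (openCluster H o).Finite)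
    (hx : x ∈ openCluster H o) : ((openGraph H).neighborSet x).Finite :=
  hfin.subset fun _ hy => Reachable.trans hx (Adj.reachable hy)

/-- **A finite cluster of an acyclic pair configuration is a finite tree with
`Σ_{x ∈ K} deg x + 2 = 2|K|`** (degrees as `Set.ncard` of the open neighbourhoods; "the average
degree in a finite tree is `< 2`", Timár 2006, proof of Lemma 5.1). The component, as a graph on
its support, is connected and acyclic, so Mathlib's `IsTree.card_edgeFinset` gives `|E| + 1 = |K|`,
and the handshake lemma `Σ deg = 2|E|`. [cite: Timar2006, Lemma 5.1 (proof: average degree of a finite tree)] -/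
theorem sum_ncard_neighborSet_add_two {H : BondConfig V} (hacyc : (openGraph H).IsAcyclic) {o : V}
    (hfin : (openCluster H o).Finite) :
    ∑ x ∈ hfin.toFinset, ((openGraph H).neighborSet x).ncard + 2 = 2 * hfin.toFinset.card := by
  classical
  set Γ := openGraph H with hΓ
  set C := Γ.connectedComponentMk o with hC
  have hK : openCluster H o = C.supp := openCluster_eq_supp H o
  haveI : Fintype C.supp := (hK ▸ hfin).fintype
  have hT : C.toSimpleGraph.IsTree :=
    ⟨ConnectedComponent.connected_toSimpleGraph C, hacyc.induce _⟩
  have hE := hT.card_edgeFinset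
  have hdeg := C.toSimpleGraph.sum_degrees_eq_twice_card_edges
  -- neighbours in the open graph stay in the component
  have hsub : ∀ v : C.supp, ∀ y : V, Γ.Adj v y → y ∈ C.supp := by
    intro v y hy
    have hv := v.2
    rw [ConnectedComponent.mem_supp_iff] at hv ⊢
    rw [← hv]
    exact ConnectedComponent.sound hy.symm.reachable
  -- degrees in the induced tree are the degrees in the open graph
  have hdv : ∀ v : C.supp, C.toSimpleGraph.degree v = (Γ.neighborSet v).ncard := by
    intro v
    rw [← card_neighborFinset_eq_degree, ← Set.ncard_coe_finset]
    have himg : (↑(C.toSimpleGraph.neighborFinset v) : Set C.supp) = (fun y : C.supp => (y : V)) ⁻¹' Γ.neighborSet v := by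
      ext y
      rw [Finset.mem_coe, mem_neighborFinset, Set.mem_preimage, mem_neighborSet]
      exact Iff.rfl
    rw [himg, Set.ncard_preimage_of_injective_subset_range Subtype.coe_injective]
    rintro y hy
    exact ⟨⟨y, hsub v y hy⟩, rfl⟩
  have hsum : ∑ x ∈ hfin.toFinset, (Γ.neighborSet x).ncard = ∑ v : C.supp, (Γ.neighborSet v).ncard := by
    refine Finset.sum_subtype _ (fun x => ?_) _
    rw [Set.Finite.mem_toFinset, hK]
  have hcard : hfin.toFinset.card = Fintype.card C.supp := by
    rw [← Set.toFinset_card]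
    congr 1
    ext x
    rw [Set.Finite.mem_toFinset, Set.mem_toFinset, hK]
  change C.toSimpleGraph.edgeFinset.card + 1 = Fintype.card C.supp at hE
  have hdeg' : ∑ v : C.supp, (Γ.neighborSet v).ncard = 2 * C.toSimpleGraph.edgeFinset.card := by
    rw [← hdeg]
    exact Finset.sum_congr rfl fun v _ => (hdv v).symm
  rw [hsum, hcard, hdeg', ← hE]
  ring

/-! ### The cluster-averaging transport for an arbitrary pair configuration -/

open Classical in
/-- **The cluster-averaging transport** of the proof of Lemma 5.1 ("start with `deg_H x` mass in
each vertex and redistribute it equally among the vertices in its (finite) cluster"):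
`T(x, y) = deg(x) / |K(x)|` if `K(x)` is finite and `y ∈ K(x)`, else `0`.
[cite: Timar2006, Lemma 5.1 (proof: the mass transport)] -/
def treeTransport (H : BondConfig V) (x y : V) : ℝ≥0∞ :=
  if (openCluster H x).Finite ∧ y ∈ openCluster H x then
    (((openGraph H).neighborSet x).ncard : ℝ≥0∞) / ((openCluster H x).ncard : ℝ≥0∞) else 0

/-- `|K(x)| ≠ 0`. [folklore] -/
theorem natCast_ncard_openCluster_ne_zero {H : BondConfig V} {x : V} (h : (openCluster H x).Finite) :
    ((openCluster H x).ncard : ℝ≥0∞) ≠ 0 := by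
  have : (openCluster H x).ncard ≠ 0 := ((Set.ncard_pos h).2 ⟨x, mem_openCluster_self H x⟩).ne'
  exact_mod_cast this

/-- **Mass sent**: `Σ_y T(x, y) = deg(x)` when `K(x)` is finite. [cite: Timar2006, Lemma 5.1 (proof: mass sent out)] -/
theorem tsum_treeTransport {H : BondConfig V} {x : V} (hfin : (openCluster H x).Finite) :
    ∑' y, treeTransport H x y = (((openGraph H).neighborSet x).ncard : ℝ≥0∞) := by
  classical
  have h : ∀ y, treeTransport H x y = (openCluster H x).indicator
      (fun _ => (((openGraph H).neighborSet x).ncard : ℝ≥0∞) / ((openCluster H x).ncard : ℝ≥0∞)) y := by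
    intro y
    by_cases hy : y ∈ openCluster H x
    · rw [treeTransport, if_pos ⟨hfin, hy⟩, Set.indicator_of_mem hy]
    · rw [treeTransport, if_neg fun h => hy h.2, Set.indicator_of_notMem hy]
  rw [tsum_congr h, ← _root_.tsum_subtype, ENNReal.tsum_set_const, ← hfin.cast_ncard_eq,
    ENat.toENNReal_coe, ENNReal.mul_div_cancel (natCast_ncard_openCluster_ne_zero hfin)
      (ENNReal.natCast_ne_top _)]

/-- When `K(x)` is infinite no mass is sent. [folklore] -/
theorem tsum_treeTransport_of_infinite {H : BondConfig V} {x : V} (hinf : (openCluster H x).Infinite) :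
    ∑' y, treeTransport H x y = 0 := by
  classical
  refine ENNReal.tsum_eq_zero.2 fun y => ?_
  rw [treeTransport, if_neg fun h => hinf h.1]

/-- Mass received at `o` comes only from `K(o)`, each `x ∈ K(o)` sending `deg(x)/|K(o)|`.
[folklore] -/
theorem treeTransport_eq_of_finite {H : BondConfig V} {o : V} (hfin : (openCluster H o).Finite)
    (x : V) : treeTransport H x o = (openCluster H o).indicator
      (fun x => (((openGraph H).neighborSet x).ncard : ℝ≥0∞) / ((openCluster H o).ncard : ℝ≥0∞)) x := by
  classical
  by_cases hx : x ∈ openCluster H o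
  · have hxo : openCluster H x = openCluster H o := by
      ext y
      exact ⟨fun hy => (show (openGraph H).Reachable o x from hx).trans hy,
        fun hy => (show (openGraph H).Reachable o x from hx).symm.trans hy⟩
    rw [Set.indicator_of_mem hx, treeTransport, hxo, if_pos ⟨hfin, mem_openCluster_self H o⟩]
  · rw [Set.indicator_of_notMem hx, treeTransport, if_neg]
    rintro ⟨-, ho⟩
    exact hx (show (openGraph H).Reachable o x from (show (openGraph H).Reachable x o from ho).symm)

/-- When `K(o)` is infinite no mass is received. [folklore] -/
theorem treeTransport_eq_zero_of_infinite {H : BondConfig V} {o : V} (hinf : (openCluster H o).Infinite)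
    (x : V) : treeTransport H x o = 0 := by
  classical
  rw [treeTransport, if_neg]
  rintro ⟨hfin, ho⟩
  have hxo : openCluster H x = openCluster H o := by
    ext y
    exact ⟨fun hy => (show (openGraph H).Reachable x o from ho).symm.trans hy,
      fun hy => (show (openGraph H).Reachable x o from ho).trans hy⟩
  exact hinf (hxo ▸ hfin)

/-- **Mass received: `|K(o)| · Σ_x T(x, o) + 2 = 2|K(o)|`** for a finite cluster of an acyclic
configuration — the mass received at `o` is the average degree `2(|K| - 1)/|K| < 2` of the finite
tree `K(o)`. [cite: Timar2006, Lemma 5.1 (proof: "the mass received by a vertex x is the average degree in its finite component")] -/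
theorem ncard_mul_tsum_treeTransport_add_two {H : BondConfig V} (hacyc : (openGraph H).IsAcyclic)
    {o : V} (hfin : (openCluster H o).Finite) :
    ((openCluster H o).ncard : ℝ≥0∞) * ∑' x, treeTransport H x o + 2 =
      2 * ((openCluster H o).ncard : ℝ≥0∞) := by
  classical
  set K := openCluster H o with hKdef
  set k : ℝ≥0∞ := (K.ncard : ℝ≥0∞) with hk
  have hk0 : k ≠ 0 := natCast_ncard_openCluster_ne_zero hfin
  have hkT : k ≠ ⊤ := ENNReal.natCast_ne_top _
  have h1 : ∑' x, treeTransport H x o =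
      (∑ x ∈ hfin.toFinset, (((openGraph H).neighborSet x).ncard : ℝ≥0∞)) / k := by
    rw [tsum_congr (treeTransport_eq_of_finite hfin)]
    rw [tsum_eq_sum (s := hfin.toFinset) fun x hx =>
      Set.indicator_of_notMem (fun h => hx ((Set.Finite.mem_toFinset hfin).2 h)) _]
    rw [Finset.sum_congr rfl fun x hx =>
      Set.indicator_of_mem ((Set.Finite.mem_toFinset hfin).1 hx) _]
    simp only [div_eq_mul_inv, Finset.sum_mul]
    rfl
  have h2 := sum_ncard_neighborSet_add_two hacyc hfin
  have hcard : (hfin.toFinset.card : ℝ≥0∞) = k := by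
    rw [hk, Set.ncard_eq_toFinset_card K hfin]
  rw [h1, ENNReal.mul_div_cancel hk0 hkT, ← hcard]
  exact_mod_cast congrArg (fun n : ℕ => (n : ℝ≥0∞)) h2

/-- **The mass received is `≤ 2`**: for an acyclic configuration with `K(o)` finite,
`Σ_x T(x, o) ≤ 2` ("the average degree in a finite tree is `< 2`").
[cite: Timar2006, Lemma 5.1 (proof: average degree of a finite tree is < 2)] -/
theorem tsum_treeTransport_le_two {H : BondConfig V} (hacyc : (openGraph H).IsAcyclic) {o : V}
    (hfin : (openCluster H o).Finite) : ∑' x, treeTransport H x o ≤ 2 := by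
  have key := ncard_mul_tsum_treeTransport_add_two hacyc hfin
  set k : ℝ≥0∞ := ((openCluster H o).ncard : ℝ≥0∞) with hk
  have hk0 : k ≠ 0 := natCast_ncard_openCluster_ne_zero hfin
  have hkT : k ≠ ⊤ := ENNReal.natCast_ne_top _
  have : k * ∑' x, treeTransport H x o ≤ k * 2 := by
    calc k * ∑' x, treeTransport H x o ≤ k * ∑' x, treeTransport H x o + 2 := le_self_add
      _ = 2 * k := key
      _ = k * 2 := mul_comm _ _
  exact (ENNReal.mul_le_mul_iff_right hk0 hkT).1 this

/-- **… and no mass is received by a vertex without open neighbours** (its cluster is `{o}` and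
its degree is `0`). [folklore] -/
theorem tsum_treeTransport_eq_zero_of_neighborSet_eq_empty {H : BondConfig V} {o : V}
    (hne : (openGraph H).neighborSet o = ∅) : ∑' x, treeTransport H x o = 0 := by
  classical
  have hK : openCluster H o = {o} := by
    refine Set.Subset.antisymm ?_ (by simp)
    intro y hy
    obtain ⟨p⟩ := (show (openGraph H).Reachable o y from hy)
    cases p with
    | nil => rfl
    | cons hadj _ =>
      have : _ ∈ (openGraph H).neighborSet o := hadj
      rw [hne] at this
      exact absurd this (Set.notMem_empty _)
  have hfin : (openCluster H o).Finite := by rw [hK]; exact Set.finite_singleton o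
  rw [tsum_congr (treeTransport_eq_of_finite hfin), hK]
  refine ENNReal.tsum_eq_zero.2 fun x => ?_
  by_cases hx : x = o
  · subst hx
    rw [Set.indicator_of_mem (Set.mem_singleton x), hne, Set.ncard_empty, Nat.cast_zero,
      ENNReal.zero_div]
  · rw [Set.indicator_of_notMem (show x ∉ ({o} : Set V) from hx)]

/-! ### Transports on an invariant space: the common setting -/

section Invariant

variable {Ω : Type*} [MeasurableSpace Ω] {G : SimpleGraph V} [G.LocallyFinite]

/-! #### Lemma 5.1 -/

/-- The open neighbourhoods of a relabelled configuration are the images of the neighbourhoods.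
[folklore] -/
theorem neighborSet_relabel (e : V ≃ V) (H : BondConfig V) (x : V) :
    (openGraph (BondConfig.relabel (sym2Equiv e) H)).neighborSet (e x) = e '' (openGraph H).neighborSet x := by
  ext y
  rw [mem_neighborSet, Set.mem_image]
  constructor
  · intro h
    refine ⟨e.symm y, ?_, e.apply_symm_apply y⟩
    rw [mem_neighborSet, ← openGraph_relabel_adj_iff e, e.apply_symm_apply]
    exact h
  · rintro ⟨z, hz, rfl⟩
    exact (openGraph_relabel_adj_iff e H x z).2 hz

omit [G.LocallyFinite] in
/-- `treeTransport` is diagonally invariant under relabelling by automorphisms. [folklore] -/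
theorem treeTransport_relabel (γ : G ≃g G) (H : BondConfig V) (x y : V) :
    treeTransport (BondConfig.relabel (sym2Equiv γ.toEquiv) H) (γ x) (γ y) = treeTransport H x y := by
  classical
  have hC : openCluster (BondConfig.relabel (sym2Equiv γ.toEquiv) H) (γ x) = (γ : V → V) '' openCluster H x :=
    openCluster_relabel γ.toEquiv H x
  have hN : (openGraph (BondConfig.relabel (sym2Equiv γ.toEquiv) H)).neighborSet (γ x) =
      (γ : V → V) '' (openGraph H).neighborSet x := neighborSet_relabel γ.toEquiv H x
  unfold treeTransport
  rw [hC, hN, Set.finite_image_iff γ.injective.injOn, γ.injective.mem_set_image,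
    Set.ncard_image_of_injective _ γ.injective, Set.ncard_image_of_injective _ γ.injective]

variable [Countable V]

/-- The event "the `H`-cluster of `x` is exactly the finite set `S`" is measurable for a measurably
varying configuration. [folklore] -/
theorem measurableSet_openCluster_eq_comp {Φ : Ω → BondConfig V} (hΦ : Measurable Φ) (x : V)
    (S : Finset V) : MeasurableSet {ξ | openCluster (Φ ξ) x = ↑S} := by
  have h : {ξ | openCluster (Φ ξ) x = ↑S} = ⋂ v, {ξ | (openGraph (Φ ξ)).Reachable x v ↔ v ∈ S} := by
    ext ξ
    simp only [Set.mem_setOf_eq, Set.mem_iInter, Set.ext_iff, Finset.mem_coe]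
    rfl
  rw [h]
  refine MeasurableSet.iInter fun v => ?_
  by_cases hv : v ∈ S
  · simp only [hv, iff_true]
    exact measurableSet_reachable_comp hΦ x v
  · simp only [hv, iff_false]
    exact (measurableSet_reachable_comp hΦ x v).compl

/-- The degree `ξ ↦ |N_{Φ ξ}(x)|` (as an extended natural, cast to `[0, ∞]`) is measurable.
[folklore] -/
theorem measurable_encard_neighborSet {Φ : Ω → BondConfig V} (hΦ : Measurable Φ) (x : V) :
    Measurable fun ξ => (((openGraph (Φ ξ)).neighborSet x).encard : ℝ≥0∞) := by
  classical
  have h : ∀ ξ, (((openGraph (Φ ξ)).neighborSet x).encard : ℝ≥0∞) =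
      ∑' y, ((openGraph (Φ ξ)).neighborSet x).indicator 1 y := by
    intro ξ
    rw [show (1 : V → ℝ≥0∞) = fun _ => 1 from rfl, tsum_indicator_const, mul_one]
  simp_rw [h]
  refine measurable_tsum_ennreal fun y => ?_
  refine measurable_one.indicator ?_
  change MeasurableSet {ξ | (openGraph (Φ ξ)).Adj x y}
  simp_rw [openGraph_adj]
  exact ((measurable_set_mem _).comp hΦ).setOf.inter (MeasurableSet.const _)

/-- **`treeTransport` depends measurably on a measurably varying configuration** (a countable
sum over the possible finite clusters `S` of `x` of `1[K(x) = S, y ∈ S] · deg(x) / |S|`).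
[folklore] -/
theorem measurable_treeTransport {Φ : Ω → BondConfig V} (hΦ : Measurable Φ) (x y : V) :
    Measurable fun ξ => treeTransport (Φ ξ) x y := by
  classical
  have h : ∀ ξ, treeTransport (Φ ξ) x y =
      ∑' S : Finset V, {ξ | openCluster (Φ ξ) x = ↑S ∧ y ∈ S}.indicator
        (fun ξ => (((openGraph (Φ ξ)).neighborSet x).encard : ℝ≥0∞) / (S.card : ℝ≥0∞)) ξ := by
    intro ξ
    by_cases hfin : (openCluster (Φ ξ) x).Finite
    · have hNfin : ((openGraph (Φ ξ)).neighborSet x).Finite :=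
        finite_neighborSet_of_finite hfin (mem_openCluster_self _ x)
      rw [tsum_eq_single hfin.toFinset]
      · by_cases hy : y ∈ openCluster (Φ ξ) x
        · have hmem : ξ ∈ {ξ' | openCluster (Φ ξ') x = ↑hfin.toFinset ∧ y ∈ hfin.toFinset} :=
            ⟨hfin.coe_toFinset.symm, hfin.mem_toFinset.2 hy⟩
          rw [Set.indicator_of_mem hmem, treeTransport, if_pos ⟨hfin, hy⟩,
            Set.ncard_eq_toFinset_card _ hfin, ← hNfin.cast_ncard_eq, ENat.toENNReal_coe]
        · rw [treeTransport, if_neg fun h => hy h.2, Set.indicator_of_notMem]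
          exact fun h => hy (hfin.mem_toFinset.1 h.2)
      · intro S hS
        rw [Set.indicator_of_notMem]
        rintro ⟨hS', -⟩
        exact hS (Finset.coe_injective (by rw [← hS', hfin.coe_toFinset]))
    · rw [treeTransport, if_neg fun h => hfin h.1]
      symm
      refine ENNReal.tsum_eq_zero.2 fun S => Set.indicator_of_notMem ?_ _
      rintro ⟨hS, -⟩
      exact hfin (hS ▸ S.finite_toSet)
  simp_rw [h]
  refine measurable_tsum_ennreal fun S => ?_
  refine Measurable.indicator ((measurable_encard_neighborSet hΦ x).div_const _) ?_
  exact (measurableSet_openCluster_eq_comp hΦ x S).inter (MeasurableSet.const _)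

omit [Countable V] in
/-- For a finite neighbourhood `encard = ncard`. [folklore] -/
theorem encard_neighborSet_eq_ncard {H : BondConfig V} {x : V} (h : ((openGraph H).neighborSet x).Finite) :
    (((openGraph H).neighborSet x).encard : ℝ≥0∞) = (((openGraph H).neighborSet x).ncard : ℝ≥0∞) := by
  rw [← h.cast_ncard_eq, ENat.toENNReal_coe]

/-- **Timár 2006, Lemma 5.1, PROVED (abstract form).** Let `P` be a measure on `Ω` preserved by
measurable maps `act γ`, `γ ∈ Aut(G)`, of a connected, locally finite, transitive graph `G`
(weights `w = autWeight G o`). Let `H : Ω → BondConfig V` be a measurable, equivariant random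
set of pairs ("a random graph on `G` that is an equivariant function of …") with a measurable
equivariant vertex set `D` containing every vertex with an `H`-neighbour, such that almost surely
the open graph of `H` is acyclic with finite clusters ("every component of `H` is a finite tree")
and every vertex `y` of the `H`-cluster of `x` has `w(y) ≤ B w(x)` (the consequence of "the
endpoints of any edge of `H` are in the same class of the 1-partition" used in the proof, with
`B = μ`). Then `E[deg_H o] ≤ 2B · P(o ∈ D)` — "the expected degree of a vertex, given that it
is in `H`, is at most `2μ`". Proof as printed: the cluster-averaging transport `treeTransport`
sends `deg_H x` out of `x` and brings the average degree `< 2` of the finite tree `K(x)` into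
`x ∈ D`; Lemma 2.2 (`lintegral_tsum_eq_inv_autWeight_mul`) with `w(y)/w(x) ≤ B` on `K(x)`.
[cite: Timar2006, Lemma 5.1] -/
theorem lintegral_encard_neighborSet_le (hconn : G.Connected) (ht : IsGraphTransitive G)
    (μ : Measure Ω) (act : (G ≃g G) → Ω → Ω) (hact : ∀ γ, Measurable (act γ))
    (hμ : ∀ γ, μ.map (act γ) = μ) {H : Ω → BondConfig V} (hHm : Measurable H)
    (hHinv : ∀ γ ξ, H (act γ ξ) = BondConfig.relabel (sym2Equiv γ.toEquiv) (H ξ))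
    {D : Ω → Set V} (hDm : ∀ x, MeasurableSet {ξ | x ∈ D ξ})
    (hHD : ∀ ξ x y, (openGraph (H ξ)).Adj x y → x ∈ D ξ)
    (htree : ∀ᵐ ξ ∂μ, (openGraph (H ξ)).IsAcyclic ∧ ∀ x, (openCluster (H ξ) x).Finite)
    (o : V) {B : ℝ≥0∞} (hBT : B ≠ ⊤)
    (hB : ∀ᵐ ξ ∂μ, ∀ x y, y ∈ openCluster (H ξ) x → autWeight G o y ≤ B * autWeight G o x) (x : V) :
    ∫⁻ ξ, (((openGraph (H ξ)).neighborSet x).encard : ℝ≥0∞) ∂μ ≤ 2 * B * μ {ξ | x ∈ D ξ} := by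
  classical
  have hmtp := lintegral_tsum_eq_inv_autWeight_mul G hconn ht μ act hact hμ
    (φ := fun x y ξ => treeTransport (H ξ) x y) (fun x y => measurable_treeTransport hHm x y)
    (fun γ x y ξ => by simp only [hHinv]; exact treeTransport_relabel γ (H ξ) x y) o x
  have hx0 := autWeight_ne_zero G hconn o x
  have hxT := autWeight_ne_top G hconn o x
  -- left side: a.s. `Σ_y T(x, y) = deg(x)`
  have hleft : ∫⁻ ξ, (((openGraph (H ξ)).neighborSet x).encard : ℝ≥0∞) ∂μ =
      ∫⁻ ξ, ∑' y, treeTransport (H ξ) x y ∂μ := by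
    refine lintegral_congr_ae ?_
    filter_upwards [htree] with ξ hξ
    rw [tsum_treeTransport (hξ.2 x), encard_neighborSet_eq_ncard]
    exact finite_neighborSet_of_finite (hξ.2 x) (mem_openCluster_self _ x)
  -- right side: `Σ_y T(y, x) w(y) ≤ B w(x) · 2 · 1[x ∈ D]`
  have hright : ∫⁻ ξ, ∑' y, treeTransport (H ξ) y x * autWeight G o y ∂μ ≤
      ∫⁻ ξ, B * autWeight G o x * {ξ | x ∈ D ξ}.indicator (fun _ => (2 : ℝ≥0∞)) ξ ∂μ := by
    refine lintegral_mono_ae ?_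
    filter_upwards [htree, hB] with ξ hξ hBξ
    have hfin := hξ.2 x
    calc ∑' y, treeTransport (H ξ) y x * autWeight G o y
        ≤ ∑' y, treeTransport (H ξ) y x * (B * autWeight G o x) := by
          refine ENNReal.tsum_le_tsum fun y => ?_
          by_cases hy : y ∈ openCluster (H ξ) x
          · exact mul_le_mul' le_rfl (hBξ x y hy)
          · rw [treeTransport_eq_of_finite hfin, Set.indicator_of_notMem hy, zero_mul, zero_mul]
      _ = (∑' y, treeTransport (H ξ) y x) * (B * autWeight G o x) := ENNReal.tsum_mul_right
      _ ≤ {ξ | x ∈ D ξ}.indicator (fun _ => (2 : ℝ≥0∞)) ξ * (B * autWeight G o x) := by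
          refine mul_le_mul' ?_ le_rfl
          by_cases hne : ((openGraph (H ξ)).neighborSet x).Nonempty
          · obtain ⟨y, hy⟩ := hne
            rw [Set.indicator_of_mem (show ξ ∈ {ξ | x ∈ D ξ} from hHD ξ x y hy)]
            exact tsum_treeTransport_le_two hξ.1 hfin
          · rw [Set.not_nonempty_iff_eq_empty] at hne
            rw [tsum_treeTransport_eq_zero_of_neighborSet_eq_empty hne]
            exact bot_le
      _ = B * autWeight G o x * {ξ | x ∈ D ξ}.indicator (fun _ => (2 : ℝ≥0∞)) ξ := by ring
  rw [hleft, hmtp]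
  calc (autWeight G o x)⁻¹ * ∫⁻ ξ, ∑' y, treeTransport (H ξ) y x * autWeight G o y ∂μ
      ≤ (autWeight G o x)⁻¹ * ∫⁻ ξ, B * autWeight G o x * {ξ | x ∈ D ξ}.indicator (fun _ => (2 : ℝ≥0∞)) ξ ∂μ :=
        mul_le_mul' le_rfl hright
    _ = (autWeight G o x)⁻¹ * (B * autWeight G o x * (2 * μ {ξ | x ∈ D ξ})) := by
        rw [lintegral_const_mul' _ _ (ENNReal.mul_ne_top hBT hxT), lintegral_indicator_const (hDm x)]
    _ = 2 * B * μ {ξ | x ∈ D ξ} := by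
        calc (autWeight G o x)⁻¹ * (B * autWeight G o x * (2 * μ {ξ | x ∈ D ξ}))
            = ((autWeight G o x)⁻¹ * autWeight G o x) * (2 * B * μ {ξ | x ∈ D ξ}) := by ring
          _ = 2 * B * μ {ξ | x ∈ D ξ} := by rw [ENNReal.inv_mul_cancel hx0 hxT, one_mul]


/-! #### Unit-mass point allocations -/

omit [G.LocallyFinite] [Countable V] in
/-- The unit-mass transport of a point allocation: `x` sends total mass `1[τ(x) defined]`.
[cite: Timar2006, Lemma 5.3 (proof: "send mass 1 to x")] -/
theorem tsum_indicator_eq_some (τ : V → Option V) (x : V) :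
    ∑' y, ({y | τ x = some y} : Set V).indicator (1 : V → ℝ≥0∞) y =
      ({x | (τ x).isSome} : Set V).indicator 1 x := by
  rw [show (1 : V → ℝ≥0∞) = fun _ => 1 from rfl, tsum_indicator_const, mul_one]
  cases h : τ x with
  | none =>
    have h0 : ({y | (none : Option V) = some y} : Set V) = ∅ := by
      ext y; simp
    rw [h0, Set.encard_empty, Set.indicator_of_notMem (by simp [h])]
    simp
  | some y₀ =>
    have h1 : ({y | some y₀ = some y} : Set V) = {y₀} := by
      ext y
      simp only [Set.mem_setOf_eq, Option.some.injEq, Set.mem_singleton_iff]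
      exact eq_comm
    rw [h1, Set.encard_singleton, Set.indicator_of_mem (show x ∈ {x | (τ x).isSome} by simp [h])]
    simp

omit [G.LocallyFinite] [Countable V] in
/-- The weighted mass received by `x` under a point allocation is `Σ_{y : τ(y) = x} w(y)`.
[folklore] -/
theorem tsum_indicator_eq_some_mul (τ : V → Option V) (x : V) (w : V → ℝ≥0∞) :
    ∑' y, ({x' | τ y = some x'} : Set V).indicator (1 : V → ℝ≥0∞) x * w y =
      ∑' y, {y | τ y = some x}.indicator w y := by
  refine tsum_congr fun y => ?_
  by_cases hy : τ y = some x
  · rw [Set.indicator_of_mem (show x ∈ {x' | τ y = some x'} from hy), Pi.one_apply, one_mul,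
      Set.indicator_of_mem (show y ∈ {y | τ y = some x} from hy)]
  · rw [Set.indicator_of_notMem (show x ∉ {x' | τ y = some x'} from hy), zero_mul,
      Set.indicator_of_notMem (show y ∉ {y | τ y = some x} from hy)]

/-- The event "`τ(x)` is defined" is measurable. [folklore] -/
theorem measurableSet_isSome {τ : Ω → V → Option V} (hτm : ∀ x y, MeasurableSet {ξ | τ ξ x = some y})
    (x : V) : MeasurableSet {ξ | (τ ξ x).isSome} := by
  have : {ξ | (τ ξ x).isSome} = ⋃ y, {ξ | τ ξ x = some y} := by
    ext ξ
    simp only [Set.mem_setOf_eq, Set.mem_iUnion, Option.isSome_iff_exists]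
  rw [this]
  exact MeasurableSet.iUnion fun y => hτm x y

/-- **The MTP for a unit-mass point allocation**: for an equivariant measurable allocation
`τ : Ω → V → Option V` ("let each vertex `y` … send mass `1` to `x`"),
`P(τ(x) is defined) = w(x)⁻¹ · E[Σ_{y : τ(y) = x} w(y)]`.
[cite: Timar2006, Lemma 5.3 (proof: MTP for unit masses)] -/
theorem measure_isSome_eq (hconn : G.Connected) (ht : IsGraphTransitive G)
    (μ : Measure Ω) (act : (G ≃g G) → Ω → Ω) (hact : ∀ γ, Measurable (act γ))
    (hμ : ∀ γ, μ.map (act γ) = μ) {τ : Ω → V → Option V}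
    (hτm : ∀ x y, MeasurableSet {ξ | τ ξ x = some y})
    (hτinv : ∀ γ ξ x, τ (act γ ξ) (γ x) = (τ ξ x).map γ) (o x : V) :
    μ {ξ | (τ ξ x).isSome} =
      (autWeight G o x)⁻¹ * ∫⁻ ξ, ∑' y, {y | τ ξ y = some x}.indicator (autWeight G o) y ∂μ := by
  classical
  have hmtp := lintegral_tsum_eq_inv_autWeight_mul G hconn ht μ act hact hμ
    (φ := fun x y ξ => ({y' | τ ξ x = some y'} : Set V).indicator (1 : V → ℝ≥0∞) y)
    (fun x y => measurable_one.indicator (hτm x y))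
    (fun γ x y ξ => by
      have key : (γ y ∈ {y' | τ (act γ ξ) (γ x) = some y'}) ↔ (y ∈ {y' | τ ξ x = some y'}) := by
        simp only [Set.mem_setOf_eq, hτinv, Option.map_eq_some_iff]
        constructor
        · rintro ⟨z, hz, hzy⟩
          rw [hz, γ.injective hzy]
        · exact fun h => ⟨y, h, rfl⟩
      simp only [Set.indicator_apply, key, Pi.one_apply]) o x
  simp only [tsum_indicator_eq_some, tsum_indicator_eq_some_mul] at hmtp
  have hconv : ∀ ξ, ({x' | (τ ξ x').isSome} : Set V).indicator (1 : V → ℝ≥0∞) x =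
      ({ξ | (τ ξ x).isSome} : Set Ω).indicator 1 ξ := by
    intro ξ; simp only [Set.indicator_apply, Set.mem_setOf_eq, Pi.one_apply]
  simp_rw [hconv] at hmtp
  rw [lintegral_indicator_one (measurableSet_isSome hτm x)] at hmtp
  exact hmtp

omit [G.LocallyFinite] in
/-- The number of vertices allocated to `x` depends measurably on `ξ`. [folklore] -/
theorem measurable_encard_fiber {τ : Ω → V → Option V} (hτm : ∀ x y, MeasurableSet {ξ | τ ξ x = some y})
    (x : V) : Measurable fun ξ => (({y | τ ξ y = some x} : Set V).encard : ℝ≥0∞) := by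
  have h : ∀ ξ, (({y | τ ξ y = some x} : Set V).encard : ℝ≥0∞) =
      ∑' y, ({y | τ ξ y = some x} : Set V).indicator 1 y := by
    intro ξ
    rw [show (1 : V → ℝ≥0∞) = fun _ => 1 from rfl, tsum_indicator_const, mul_one]
  simp_rw [h]
  refine measurable_tsum_ennreal fun y => measurable_one.indicator ?_
  exact hτm y x

/-- **The number of vertices allocated to `x` has finite expectation `≤ B · P(τ(x) defined) ≤ B`**
whenever `w(τ(y)) ≤ B w(y)` for all allocated `y` (the targets are not much heavier than the
senders: "the expected mass sent out is at most 1" forces finite expected mass received).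
[cite: Timar2006, Lemma 5.3 (proof: expected mass sent ≤ 1, received finite)] -/
theorem lintegral_encard_fiber_le (hconn : G.Connected) (ht : IsGraphTransitive G)
    (μ : Measure Ω) (act : (G ≃g G) → Ω → Ω) (hact : ∀ γ, Measurable (act γ))
    (hμ : ∀ γ, μ.map (act γ) = μ) {τ : Ω → V → Option V}
    (hτm : ∀ x y, MeasurableSet {ξ | τ ξ x = some y})
    (hτinv : ∀ γ ξ x, τ (act γ ξ) (γ x) = (τ ξ x).map γ) (o : V) {B : ℝ≥0∞} (hBT : B ≠ ⊤)
    (hB : ∀ ξ y x, τ ξ y = some x → autWeight G o x ≤ B * autWeight G o y) (x : V) :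
    ∫⁻ ξ, (({y | τ ξ y = some x} : Set V).encard : ℝ≥0∞) ∂μ ≤ B * μ {ξ | (τ ξ x).isSome} := by
  classical
  have hx0 := autWeight_ne_zero G hconn o x
  have hxT := autWeight_ne_top G hconn o x
  have hmtp := measure_isSome_eq hconn ht μ act hact hμ hτm hτinv o x
  -- pointwise: `w(x) · #fiber ≤ B · Σ_{fiber} w(y)`
  have hpt : ∀ ξ, autWeight G o x * (({y | τ ξ y = some x} : Set V).encard : ℝ≥0∞) ≤
      B * ∑' y, {y | τ ξ y = some x}.indicator (autWeight G o) y := by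
    intro ξ
    rw [mul_comm, ← tsum_indicator_const, ← ENNReal.tsum_mul_left]
    refine ENNReal.tsum_le_tsum fun y => ?_
    by_cases hy : τ ξ y = some x
    · rw [Set.indicator_of_mem (show y ∈ {y | τ ξ y = some x} from hy),
        Set.indicator_of_mem (show y ∈ {y | τ ξ y = some x} from hy)]
      exact hB ξ y x hy
    · rw [Set.indicator_of_notMem (show y ∉ {y | τ ξ y = some x} from hy),
        Set.indicator_of_notMem (show y ∉ {y | τ ξ y = some x} from hy), mul_zero]
  have hint : autWeight G o x * ∫⁻ ξ, (({y | τ ξ y = some x} : Set V).encard : ℝ≥0∞) ∂μ ≤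
      B * (autWeight G o x * μ {ξ | (τ ξ x).isSome}) := by
    calc autWeight G o x * ∫⁻ ξ, (({y | τ ξ y = some x} : Set V).encard : ℝ≥0∞) ∂μ
        = ∫⁻ ξ, autWeight G o x * (({y | τ ξ y = some x} : Set V).encard : ℝ≥0∞) ∂μ :=
          (lintegral_const_mul' _ _ hxT).symm
      _ ≤ ∫⁻ ξ, B * ∑' y, {y | τ ξ y = some x}.indicator (autWeight G o) y ∂μ := lintegral_mono hpt
      _ = B * ∫⁻ ξ, ∑' y, {y | τ ξ y = some x}.indicator (autWeight G o) y ∂μ :=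
          lintegral_const_mul' _ _ hBT
      _ = B * (autWeight G o x * μ {ξ | (τ ξ x).isSome}) := by
          rw [hmtp, ← mul_assoc (autWeight G o x), ENNReal.mul_inv_cancel hx0 hxT, one_mul]
  calc ∫⁻ ξ, (({y | τ ξ y = some x} : Set V).encard : ℝ≥0∞) ∂μ
      = (autWeight G o x)⁻¹ * (autWeight G o x * ∫⁻ ξ, (({y | τ ξ y = some x} : Set V).encard : ℝ≥0∞) ∂μ) := by
        rw [← mul_assoc, ENNReal.inv_mul_cancel hx0 hxT, one_mul]
    _ ≤ (autWeight G o x)⁻¹ * (B * (autWeight G o x * μ {ξ | (τ ξ x).isSome})) := mul_le_mul' le_rfl hint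
    _ = B * μ {ξ | (τ ξ x).isSome} := by
        calc (autWeight G o x)⁻¹ * (B * (autWeight G o x * μ {ξ | (τ ξ x).isSome}))
            = ((autWeight G o x)⁻¹ * autWeight G o x) * (B * μ {ξ | (τ ξ x).isSome}) := by ring
          _ = B * μ {ξ | (τ ξ x).isSome} := by rw [ENNReal.inv_mul_cancel hx0 hxT, one_mul]

omit [Countable V] in
/-- **… hence almost surely only finitely many vertices are allocated to `x`** (for a finite
measure). [cite: Timar2006, Lemma 5.3 (proof: the mass received is a.s. finite)] -/
theorem ae_finite_fiber (hconn : G.Connected) (ht : IsGraphTransitive G)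
    (μ : Measure Ω) [IsFiniteMeasure μ] (act : (G ≃g G) → Ω → Ω) (hact : ∀ γ, Measurable (act γ))
    (hμ : ∀ γ, μ.map (act γ) = μ) {τ : Ω → V → Option V}
    (hτm : ∀ x y, MeasurableSet {ξ | τ ξ x = some y})
    (hτinv : ∀ γ ξ x, τ (act γ ξ) (γ x) = (τ ξ x).map γ) (o : V) {B : ℝ≥0∞} (hBT : B ≠ ⊤)
    (hB : ∀ ξ y x, τ ξ y = some x → autWeight G o x ≤ B * autWeight G o y) :
    ∀ᵐ ξ ∂μ, ∀ x, ({y | τ ξ y = some x} : Set V).Finite := by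
  haveI : Countable V := countable_of_connected_of_locallyFinite G hconn o
  rw [ae_all_iff]
  intro x
  have hlt : ∫⁻ ξ, (({y | τ ξ y = some x} : Set V).encard : ℝ≥0∞) ∂μ < ⊤ :=
    lt_of_le_of_lt (lintegral_encard_fiber_le hconn ht μ act hact hμ hτm hτinv o hBT hB x)
      (ENNReal.mul_lt_top hBT.lt_top (measure_lt_top _ _))
  filter_upwards [ae_lt_top (measurable_encard_fiber hτm x) hlt.ne] with ξ hξ
  rw [← Set.encard_lt_top_iff, ← ENat.toENNReal_lt_top]
  exact hξ

omit [Countable V] in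
/-- **Conversely, `P(τ(x) defined) ≤ B · E[#{y : τ(y) = x}]`** whenever `w(y) ≤ B w(τ(y))` for
all allocated `y` (the senders are not much heavier than the targets) — the inequality behind
"choose an invariant partition of `F` into finite bags so that the expected number of bags that
a bag on a fixed vertex is adjacent to is `> 2μ`" (Timár 2006, proof of Thm. 5.5).
[cite: Timar2006, Thm. 5.5 (proof: bags and leaders)] -/
theorem measure_isSome_le (hconn : G.Connected) (ht : IsGraphTransitive G)
    (μ : Measure Ω) (act : (G ≃g G) → Ω → Ω) (hact : ∀ γ, Measurable (act γ))
    (hμ : ∀ γ, μ.map (act γ) = μ) {τ : Ω → V → Option V}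
    (hτm : ∀ x y, MeasurableSet {ξ | τ ξ x = some y})
    (hτinv : ∀ γ ξ x, τ (act γ ξ) (γ x) = (τ ξ x).map γ) (o : V) {B : ℝ≥0∞}
    (hB : ∀ ξ y x, τ ξ y = some x → autWeight G o y ≤ B * autWeight G o x) (x : V) :
    μ {ξ | (τ ξ x).isSome} ≤ B * ∫⁻ ξ, (({y | τ ξ y = some x} : Set V).encard : ℝ≥0∞) ∂μ := by
  classical
  haveI : Countable V := countable_of_connected_of_locallyFinite G hconn o
  have hx0 := autWeight_ne_zero G hconn o x
  have hxT := autWeight_ne_top G hconn o x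
  have hmtp := measure_isSome_eq hconn ht μ act hact hμ hτm hτinv o x
  -- pointwise: `Σ_{fiber} w(y) ≤ w(x) · B · #fiber`
  have hpt : ∀ ξ, ∑' y, {y | τ ξ y = some x}.indicator (autWeight G o) y ≤
      autWeight G o x * (B * (({y | τ ξ y = some x} : Set V).encard : ℝ≥0∞)) := by
    intro ξ
    rw [← mul_assoc, mul_comm (autWeight G o x * B), ← tsum_indicator_const]
    refine ENNReal.tsum_le_tsum fun y => ?_
    by_cases hy : τ ξ y = some x
    · rw [Set.indicator_of_mem (show y ∈ {y | τ ξ y = some x} from hy),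
        Set.indicator_of_mem (show y ∈ {y | τ ξ y = some x} from hy), mul_comm]
      exact hB ξ y x hy
    · rw [Set.indicator_of_notMem (show y ∉ {y | τ ξ y = some x} from hy),
        Set.indicator_of_notMem (show y ∉ {y | τ ξ y = some x} from hy)]
  rw [hmtp]
  calc (autWeight G o x)⁻¹ * ∫⁻ ξ, ∑' y, {y | τ ξ y = some x}.indicator (autWeight G o) y ∂μ
      ≤ (autWeight G o x)⁻¹ * ∫⁻ ξ, autWeight G o x * (B * (({y | τ ξ y = some x} : Set V).encard : ℝ≥0∞)) ∂μ :=
        mul_le_mul' le_rfl (lintegral_mono hpt)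
    _ = (autWeight G o x)⁻¹ * (autWeight G o x * ∫⁻ ξ, B * (({y | τ ξ y = some x} : Set V).encard : ℝ≥0∞) ∂μ) := by
        rw [lintegral_const_mul' _ _ hxT]
    _ = ∫⁻ ξ, B * (({y | τ ξ y = some x} : Set V).encard : ℝ≥0∞) ∂μ := by
        rw [← mul_assoc, ENNReal.inv_mul_cancel hx0 hxT, one_mul]
    _ = B * ∫⁻ ξ, (({y | τ ξ y = some x} : Set V).encard : ℝ≥0∞) ∂μ := by
        rw [lintegral_const_mul'' _ ((measurable_encard_fiber hτm x).aemeasurable)]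

end Invariant

end Literature.Barriers.CriticalPhenomena

end
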